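import Mathlib
import HarnessLib
import Literature.Analysis.FluidPDE.VectorCalculus
import Literature.Analysis.FluidPDE.VectorCalculusProofs
import Literature.Analysis.FluidPDE.VorticityCalculus
import Literature.Analysis.FluidPDE.TaoEnstrophyLocalisation
import Literature.Analysis.FluidPDE.WholeSpaceIBP
import Literature.Analysis.FluidPDE.ClassicalSolution
import Literature.Analysis.FluidPDE.ClassicalSolutionCalculus
import Literature.Analysis.FluidPDE.SpaceTimeCalculus
import Literature.Analysis.FluidPDE.SelfSimilar
import Literature.Analysis.FluidPDE.NSBoundedMildOseen
import Literature.Analysis.FluidPDE.SuitableWeak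
import Literature.Analysis.FluidPDE.WeakSolution
import Literature.Analysis.FluidPDE.LocalTypeI
import Literature.Analysis.UnboundedOperators.HeatKernel

/-!
# `FilamentPinchDoor.FilamentPinchLiouville` (stmt-NavierStokesRegularity-26430) — WINDOW CALCULUS for the
# energy-class windowed Kelvin law (helper file for the registered stub `stub_frozenFlux`, skeleton r2, line `birth`)

Tools, all sign-free and elementary:
* parabolic rescaling `y ↦ g(L⁻¹(y − a))`: chain rule and `Δ(g(L⁻¹(· − a))) = L⁻² (Δg)(L⁻¹(· − a))`
  (`fderiv_comp_invScale`, `laplacian_comp_invScale`);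
* the divergence-free test field `W = curl(ψ e) = curlCLM(Dψ ⊗ e)` of a scalar window `ψ` and a constant vector `e`
  (`curl_smul_const_eq`, `divergence_testField_eq_zero`, smoothness, compact support, rescaling `testField_invScale`),
  and the velocity form of the windowed circulation `∫ ⟪curl w, e⟫ ψ = ∫ ⟪w, W⟫` (`integral_inner_curl_mul_window_eq`);
* `d/dt ∫⟪v(t), W⟫ = ∫ (⟪v, (v·∇)W⟫ + ⟪v, ΔW⟫)` for a classical solution of the unforced unit-viscosity system on
  `(−∞,0)` and a smooth compactly supported divergence-free `W` (`hasDerivAt_integral_inner_test`: Leray's slice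
  identity, the pressure drops out);
* the flux bound `|∫ (⟪w, (w·∇)W⟫ + ⟪w, ΔW⟫)| ≤ ‖DW‖_∞ ∫_K‖w‖² + ‖ΔW‖_∞ (L∫_K‖w‖² + L⁻¹|K|)/2`
  (`abs_integral_flux_le`) and the real form of the slice Morrey bound (`setIntegral_norm_sq_le_of_subset_ball`).

HONEST FRAMING: calculus lemmas serving a structural statement about HYPOTHETICAL Type-I blow-up profiles; nothing
here bears on Navier–Stokes regularity; no summit statement is proved.
-/

noncomputable section

-- the summit and its single sub-problem share the name (CONVENTIONS §1), as in every Theorems file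
set_option linter.dupNamespace false

namespace Summit.NavierStokesRegularity.NavierStokesRegularity.Theorems.FilamentPinchDoorFilamentPinchLiouvilleWindowCalculus

open Set Function Filter MeasureTheory Metric Topology InnerProductSpace
open scoped ENNReal NNReal RealInnerProductSpace Laplacian ContDiff
open Literature.Analysis Literature.Analysis.FluidPDE

/-! ### Calculus of the parabolic window rescaling `y ↦ g(L⁻¹(y − a))` -/

section Homothety

variable {F : Type*} [NormedAddCommGroup F] [NormedSpace ℝ F]

/-- Chain rule for `y ↦ g (L⁻¹ • (y − a))`. [folklore] -/
theorem hasFDerivAt_comp_invScale {g : (EuclideanSpace ℝ (Fin 3)) → F} {g' : (EuclideanSpace ℝ (Fin 3)) →L[ℝ] F} {L : ℝ} {a y : (EuclideanSpace ℝ (Fin 3))}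
    (hg : HasFDerivAt g g' (L⁻¹ • (y - a))) :
    HasFDerivAt (fun y => g (L⁻¹ • (y - a))) (L⁻¹ • g') y := by
  have hT : HasFDerivAt (fun y : (EuclideanSpace ℝ (Fin 3)) => L⁻¹ • (y - a)) (L⁻¹ • ContinuousLinearMap.id ℝ (EuclideanSpace ℝ (Fin 3))) y :=
    ((hasFDerivAt_id y).sub_const a).const_smul L⁻¹
  refine (hg.comp y hT).congr_fderiv ?_
  ext h
  simp

/-- `D(g(L⁻¹(· − a)))(y) = L⁻¹ · Dg(L⁻¹(y − a))` for differentiable `g`. [folklore] -/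
theorem fderiv_comp_invScale {g : (EuclideanSpace ℝ (Fin 3)) → F} (hg : Differentiable ℝ g) (L : ℝ) (a y : (EuclideanSpace ℝ (Fin 3))) :
    fderiv ℝ (fun y => g (L⁻¹ • (y - a))) y = L⁻¹ • fderiv ℝ g (L⁻¹ • (y - a)) :=
  (hasFDerivAt_comp_invScale (hg _).hasFDerivAt).fderiv

/-- Smoothness of the rescaled function. [folklore] -/
theorem contDiff_comp_invScale {g : (EuclideanSpace ℝ (Fin 3)) → F} {n : WithTop ℕ∞} (hg : ContDiff ℝ n g) (L : ℝ) (a : (EuclideanSpace ℝ (Fin 3))) :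
    ContDiff ℝ n fun y => g (L⁻¹ • (y - a)) :=
  hg.comp ((contDiff_id.sub contDiff_const).const_smul L⁻¹)

/-- **Laplacian of a parabolic rescaling**: `Δ(g(L⁻¹(· − a)))(y) = L⁻² Δg(L⁻¹(y − a))` for `g ∈ C²`. [folklore] -/
theorem laplacian_comp_invScale {g : (EuclideanSpace ℝ (Fin 3)) → F} (hg : ContDiff ℝ 2 g) (L : ℝ) (a y : (EuclideanSpace ℝ (Fin 3))) :
    Δ (fun y => g (L⁻¹ • (y - a))) y = (L⁻¹) ^ 2 • Δ g (L⁻¹ • (y - a)) := by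
  set b := stdOrthonormalBasis ℝ (EuclideanSpace ℝ (Fin 3)) with hb
  rw [laplacian_eq_iteratedFDeriv_orthonormalBasis _ b, laplacian_eq_iteratedFDeriv_orthonormalBasis _ b]
  change ∑ i, iteratedFDeriv ℝ 2 (fun y => g (L⁻¹ • (y - a))) y ![b i, b i] =
    (L⁻¹) ^ 2 • ∑ i, iteratedFDeriv ℝ 2 g (L⁻¹ • (y - a)) ![b i, b i]
  set A : (EuclideanSpace ℝ (Fin 3)) →L[ℝ] (EuclideanSpace ℝ (Fin 3)) := L⁻¹ • ContinuousLinearMap.id ℝ (EuclideanSpace ℝ (Fin 3)) with hA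
  set g₁ : (EuclideanSpace ℝ (Fin 3)) → F := fun z => g (z - L⁻¹ • a) with hg₁_def
  have hg₁ : ContDiff ℝ 2 g₁ := hg.comp (contDiff_id.sub contDiff_const)
  have e : (fun y => g (L⁻¹ • (y - a))) = g₁ ∘ A := by
    funext z
    simp [hg₁_def, hA, smul_sub]
  rw [e, Finset.smul_sum]
  refine Finset.sum_congr rfl fun i _ => ?_
  rw [A.iteratedFDeriv_comp_right hg₁ y (i := 2) le_rfl, ContinuousMultilinearMap.compContinuousLinearMap_apply]
  have h3 : (fun k : Fin 2 => A (![b i, b i] k)) = fun k => L⁻¹ • (![b i, b i] k) := by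
    funext k; simp [hA]
  rw [h3, ContinuousMultilinearMap.map_smul_univ, Fin.prod_const, hg₁_def, iteratedFDeriv_comp_sub]
  congr 2
  simp [hA, smul_sub]

end Homothety


/-! ### The divergence-free test field `curl(ψ e) = ∇ψ × e` -/

section TestField

/-- `curl (ψ e)(y) = curlCLM (Dψ(y) ⊗ e)` (`= ∇ψ(y) × e`) for a scalar `ψ` differentiable at `y` and a constant
vector `e` (Leibniz rule `curl_smul`; the constant field is curl-free). [folklore] -/
theorem curl_smul_const_eq {ψ : (EuclideanSpace ℝ (Fin 3)) → ℝ} {y : (EuclideanSpace ℝ (Fin 3))} (hψ : DifferentiableAt ℝ ψ y) (e : (EuclideanSpace ℝ (Fin 3))) :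
    curl (fun z => ψ z • e) y = curlCLM ((fderiv ℝ ψ y).smulRight e) := by
  rw [curl_smul hψ (differentiableAt_const e)]
  have h0 : curl (fun _ : (EuclideanSpace ℝ (Fin 3)) => e) y = 0 := curl_eq_zero_of_fderiv_eq_zero (by simp)
  rw [h0, smul_zero, zero_add]

/-- The test field `y ↦ curlCLM (Dψ(y) ⊗ e) = curl (ψ e)` is divergence-free for `ψ ∈ C²`
(`div curl = 0`). [folklore] -/
theorem divergence_testField_eq_zero {ψ : (EuclideanSpace ℝ (Fin 3)) → ℝ} (hψ : ContDiff ℝ 2 ψ) (e y : (EuclideanSpace ℝ (Fin 3))) :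
    VectorCalculus.divergence (fun z => curlCLM ((fderiv ℝ ψ z).smulRight e)) y = 0 := by
  have h : (fun z => curlCLM ((fderiv ℝ ψ z).smulRight e)) = curl (fun z => ψ z • e) :=
    funext fun z => (curl_smul_const_eq ((hψ.differentiable two_ne_zero) z) e).symm
  rw [h]
  exact divergence_curl_eq_zero_holds _ (hψ.smul contDiff_const) y

/-- The test field is smooth for smooth `ψ`. [folklore] -/
theorem contDiff_testField {ψ : (EuclideanSpace ℝ (Fin 3)) → ℝ} (hψ : ContDiff ℝ ∞ ψ) (e : (EuclideanSpace ℝ (Fin 3))) :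
    ContDiff ℝ ∞ fun z => curlCLM ((fderiv ℝ ψ z).smulRight e) :=
  curlCLM.contDiff.comp ((hψ.fderiv_right (m := ∞) (by norm_cast)).smulRight contDiff_const)

/-- The test field is compactly supported for compactly supported `ψ`. [folklore] -/
theorem hasCompactSupport_testField {ψ : (EuclideanSpace ℝ (Fin 3)) → ℝ} (hψc : HasCompactSupport ψ) (e : (EuclideanSpace ℝ (Fin 3))) :
    HasCompactSupport fun z => curlCLM ((fderiv ℝ ψ z).smulRight e) := by
  refine (hψc.fderiv (𝕜 := ℝ)).mono fun z hz => ?_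
  contrapose! hz
  simp only [mem_support, not_not] at hz
  simp [hz]

/-- **Parabolic rescaling of the test field**: for the window `ψ = φ(L⁻¹(· − a))`,
`curlCLM (Dψ(y) ⊗ e) = L⁻¹ · curlCLM (Dφ(L⁻¹(y − a)) ⊗ e)`. [folklore] -/
theorem testField_invScale {φ : (EuclideanSpace ℝ (Fin 3)) → ℝ} (hφ : Differentiable ℝ φ) (e : (EuclideanSpace ℝ (Fin 3))) (L : ℝ) (a y : (EuclideanSpace ℝ (Fin 3))) :
    curlCLM ((fderiv ℝ (fun y => φ (L⁻¹ • (y - a))) y).smulRight e) =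
      L⁻¹ • curlCLM ((fderiv ℝ φ (L⁻¹ • (y - a))).smulRight e) := by
  rw [fderiv_comp_invScale hφ L a y, ← map_smul]
  congr 1
  ext h
  simp [mul_smul]

/-- **The windowed circulation is a velocity pairing**: for a `C¹` field `w` and a `C¹` compactly supported
window `ψ`, `∫ ⟪curl w, e⟫ ψ = ∫ ⟪w, curl(ψ e)⟫ = ∫ ⟪w, curlCLM (Dψ ⊗ e)⟫` (integration by parts for the
curl, tree `integral_mul_inner_curl_eq`). [folklore] -/
theorem integral_inner_curl_mul_window_eq {w : (EuclideanSpace ℝ (Fin 3)) → (EuclideanSpace ℝ (Fin 3))} {ψ : (EuclideanSpace ℝ (Fin 3)) → ℝ} (hw : ContDiff ℝ 1 w)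
    (hψ : ContDiff ℝ 1 ψ) (hψc : HasCompactSupport ψ) (e : (EuclideanSpace ℝ (Fin 3))) :
    ∫ y, ⟪curl w y, e⟫ * ψ y = ∫ y, ⟪w y, curlCLM ((fderiv ℝ ψ y).smulRight e)⟫ := by
  have h1 : ∫ y, ⟪curl w y, e⟫ * ψ y = ∫ y, ψ y * ⟪curl w y, (fun _ : (EuclideanSpace ℝ (Fin 3)) => e) y⟫ :=
    integral_congr_ae (Eventually.of_forall fun y => mul_comm _ _)
  rw [h1, integral_mul_inner_curl_eq hw contDiff_const hψ hψc]
  have h0 : ∀ y, curl (fun _ : (EuclideanSpace ℝ (Fin 3)) => e) y = 0 := fun y => curl_eq_zero_of_fderiv_eq_zero (by simp)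
  simp [h0]

end TestField

/-! ### The time derivative of the pairing `∫ ⟪v(t), W⟫` for a classical solution -/

section Pairing

variable {v : ℝ → (EuclideanSpace ℝ (Fin 3)) → (EuclideanSpace ℝ (Fin 3))} {q : ℝ → (EuclideanSpace ℝ (Fin 3)) → ℝ}

/-- **`d/dt ∫ ⟪v(t), W⟫ = ∫ (⟪v, (v·∇)W⟫ + ⟪v, ΔW⟫)`** for a classical solution of the unforced unit-viscosity
Navier–Stokes system on `(−∞,0)` and a smooth compactly supported divergence-free field `W` (differentiation
under the integral sign, tree `hasDerivAt_integral_of_support_subset`; then Leray's slice identity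
`IsClassicalNSSolutionOn.integral_inner_timeDerivWithin_test`: the pressure drops out against `div W = 0` and the
viscous and convective terms are moved onto `W`). [cite: Leray1934, (17) p. 206] -/
theorem hasDerivAt_integral_inner_test (hcl : IsClassicalNSSolutionOn (Iio (0 : ℝ)) 1 0 v q)
    {W : (EuclideanSpace ℝ (Fin 3)) → (EuclideanSpace ℝ (Fin 3))} (hW : ContDiff ℝ ∞ W) (hWc : HasCompactSupport W)
    (hdiv : VectorCalculus.IsDivFree W) {t : ℝ} (ht : t < 0) :
    HasDerivAt (fun s => ∫ y, ⟪v s y, W y⟫)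
      (∫ y, (⟪v t y, convect (v t) W y⟫ + ⟪v t y, (Δ W) y⟫)) t := by
  have hS : IsOpen (Iio (0 : ℝ)) := isOpen_Iio
  have ht' : t ∈ Iio (0 : ℝ) := ht
  have hΦ : IsSmoothSpaceTimeOn (Iio (0 : ℝ)) fun s y => ⟪v s y, W y⟫ :=
    hcl.smooth_velocity.inner (isSmoothSpaceTimeOn_const_time hW _)
  have hsupp : ∀ s ∈ Iio (0 : ℝ), ∀ y ∉ tsupport W, ⟪v s y, W y⟫ = 0 := fun s _ y hy => by
    rw [image_eq_zero_of_notMem_tsupport hy, inner_zero_right]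
  have hD := hasDerivAt_integral_of_support_subset (μ := volume) hS hΦ hWc hsupp ht'
  -- the pointwise time derivative is `⟪∂ₜv, W⟫`
  have hpt : ∀ y, deriv (fun s => ⟪v s y, W y⟫) t = ⟪timeDerivWithin (Iio (0 : ℝ)) v t y, W y⟫ := by
    intro y
    have hl : HasDerivAt (fun s => v s y) (deriv (fun s => v s y) t) t :=
      hcl.smooth_velocity.hasDerivAt_timeLine hS ht' y
    have h1 := (hl.inner ℝ (hasDerivAt_const t (W y))).deriv
    rw [timeDerivWithin_eq_deriv hS ht']
    simpa using h1
  have heq : ∫ y, deriv (fun s => ⟪v s y, W y⟫) t =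
      ∫ y, (⟪v t y, convect (v t) W y⟫ + ⟪v t y, (Δ W) y⟫) := by
    rw [integral_congr_ae (Eventually.of_forall hpt),
      hcl.integral_inner_timeDerivWithin_test hS.uniqueDiffOn ht' (hW.of_le (by norm_cast)) hWc hdiv]
    refine integral_congr_ae (Eventually.of_forall fun y => ?_)
    simp
  rw [heq] at hD
  exact hD

end Pairing


/-! ### The flux bound: `|∫ (⟪v, (v·∇)W⟫ + ⟪v, ΔW⟫)| ≤ ‖DW‖_∞ ∫_K |v|² + ‖ΔW‖_∞ ∫_K |v|` -/

section FluxBound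

/-- AM–GM at scale `L`: `‖x‖ ≤ (L‖x‖² + L⁻¹)/2`. [folklore] -/
theorem norm_le_scale_amgm (x : (EuclideanSpace ℝ (Fin 3))) {L : ℝ} (hL : 0 < L) : ‖x‖ ≤ (L * ‖x‖ ^ 2 + L⁻¹) / 2 := by
  have h : 0 ≤ (L * ‖x‖ - 1) ^ 2 := sq_nonneg _
  rw [le_div_iff₀ (by norm_num : (0 : ℝ) < 2)]
  have h2 : ‖x‖ * 2 * L ≤ (L * ‖x‖ ^ 2 + L⁻¹) * L := by
    rw [add_mul, inv_mul_cancel₀ hL.ne']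
    nlinarith [h]
  exact le_of_mul_le_mul_right h2 hL

/-- **Flux bound.**  For a continuous field `w`, a test field `W` whose gradient and Laplacian vanish off a
compact set `K` and are bounded by `D₁`, `D₂`, and `∫_K ‖w‖² ≤ E₂`:
`|∫ (⟪w, (w·∇)W⟫ + ⟪w, ΔW⟫)| ≤ D₁ E₂ + D₂ (L E₂ + L⁻¹ |K|)/2` for every `L > 0` (Cauchy–Schwarz-free:
`‖w‖ ≤ (L‖w‖² + L⁻¹)/2`). [folklore] -/
theorem abs_integral_flux_le {w W : (EuclideanSpace ℝ (Fin 3)) → (EuclideanSpace ℝ (Fin 3))} (hw : Continuous w)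
    {K : Set (EuclideanSpace ℝ (Fin 3))} (hK : IsCompact K)
    (hDK : ∀ y, y ∉ K → fderiv ℝ W y = 0) (hΔK : ∀ y, y ∉ K → (Δ W) y = 0)
    {D₁ D₂ : ℝ} (hD₁ : ∀ y, ‖fderiv ℝ W y‖ ≤ D₁) (hD₂ : ∀ y, ‖(Δ W) y‖ ≤ D₂)
    {E₂ : ℝ} (hE₂ : ∫ y in K, ‖w y‖ ^ 2 ≤ E₂) {L : ℝ} (hL : 0 < L) :
    |∫ y, (⟪w y, convect w W y⟫ + ⟪w y, (Δ W) y⟫)| ≤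
      D₁ * E₂ + D₂ * ((L * E₂ + L⁻¹ * (volume K).toReal) / 2) := by
  have hD₁0 : 0 ≤ D₁ := (norm_nonneg _).trans (hD₁ 0)
  have hD₂0 : 0 ≤ D₂ := (norm_nonneg _).trans (hD₂ 0)
  have hKm : MeasurableSet K := hK.isClosed.measurableSet
  have hKfin : volume K < ⊤ := hK.measure_lt_top
  -- pointwise majorant
  have hgc : Continuous fun y => D₁ * ‖w y‖ ^ 2 + D₂ * ‖w y‖ :=
    (continuous_const.mul (hw.norm.pow 2)).add (continuous_const.mul hw.norm)
  have hpt : ∀ y, ‖⟪w y, convect w W y⟫ + ⟪w y, (Δ W) y⟫‖ ≤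
      K.indicator (fun y => D₁ * ‖w y‖ ^ 2 + D₂ * ‖w y‖) y := by
    intro y
    rw [Real.norm_eq_abs]
    by_cases hy : y ∈ K
    · have h1 : |⟪w y, convect w W y⟫| ≤ D₁ * ‖w y‖ ^ 2 := by
        rw [convect_apply]
        have hop : ‖fderiv ℝ W y (w y)‖ ≤ D₁ * ‖w y‖ :=
          (ContinuousLinearMap.le_opNorm _ _).trans (mul_le_mul_of_nonneg_right (hD₁ y) (norm_nonneg _))
        calc |⟪w y, fderiv ℝ W y (w y)⟫| ≤ ‖w y‖ * ‖fderiv ℝ W y (w y)‖ := abs_real_inner_le_norm _ _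
          _ ≤ ‖w y‖ * (D₁ * ‖w y‖) := mul_le_mul_of_nonneg_left hop (norm_nonneg _)
          _ = D₁ * ‖w y‖ ^ 2 := by ring
      have h2 : |⟪w y, (Δ W) y⟫| ≤ D₂ * ‖w y‖ := by
        calc |⟪w y, (Δ W) y⟫| ≤ ‖w y‖ * ‖(Δ W) y‖ := abs_real_inner_le_norm _ _
          _ ≤ ‖w y‖ * D₂ := mul_le_mul_of_nonneg_left (hD₂ y) (norm_nonneg _)
          _ = D₂ * ‖w y‖ := by ring
      rw [indicator_of_mem hy]
      exact (abs_add_le _ _).trans (add_le_add h1 h2)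
    · rw [indicator_of_notMem hy, convect_apply, hDK y hy, hΔK y hy]
      simp
  have hint : Integrable (K.indicator fun y => D₁ * ‖w y‖ ^ 2 + D₂ * ‖w y‖) := by
    rw [integrable_indicator_iff hKm]
    exact hgc.continuousOn.integrableOn_compact hK
  -- integrate
  have i1 : IntegrableOn (fun y => ‖w y‖ ^ 2) K := (hw.norm.pow 2).continuousOn.integrableOn_compact hK
  have i2 : IntegrableOn (fun y => ‖w y‖) K := hw.norm.continuousOn.integrableOn_compact hK
  have i3 : IntegrableOn (fun _ : (EuclideanSpace ℝ (Fin 3)) => L⁻¹) K := integrableOn_const hKfin.ne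
  have hsplit : ∫ y in K, (D₁ * ‖w y‖ ^ 2 + D₂ * ‖w y‖) =
      D₁ * (∫ y in K, ‖w y‖ ^ 2) + D₂ * ∫ y in K, ‖w y‖ := by
    rw [integral_add (i1.const_mul D₁) (i2.const_mul D₂), integral_const_mul, integral_const_mul]
  have h1 : |∫ y, (⟪w y, convect w W y⟫ + ⟪w y, (Δ W) y⟫)| ≤
      D₁ * (∫ y in K, ‖w y‖ ^ 2) + D₂ * ∫ y in K, ‖w y‖ := by
    rw [← Real.norm_eq_abs, ← hsplit, ← integral_indicator hKm]
    exact norm_integral_le_of_norm_le hint (Eventually.of_forall hpt)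
  have i4 : IntegrableOn (fun y => (L * ‖w y‖ ^ 2 + L⁻¹) / 2) K := ((i1.const_mul L).add i3).div_const 2
  have h2 : ∫ y in K, ‖w y‖ ≤ (L * E₂ + L⁻¹ * (volume K).toReal) / 2 := by
    calc ∫ y in K, ‖w y‖ ≤ ∫ y in K, (L * ‖w y‖ ^ 2 + L⁻¹) / 2 :=
          setIntegral_mono_on i2 i4 hKm (fun y _ => norm_le_scale_amgm (w y) hL)
      _ = (L * (∫ y in K, ‖w y‖ ^ 2) + L⁻¹ * (volume K).toReal) / 2 := by
          rw [integral_div, integral_add (i1.const_mul L) i3, integral_const_mul, setIntegral_const]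
          simp [Measure.real, mul_comm]
      _ ≤ (L * E₂ + L⁻¹ * (volume K).toReal) / 2 := by
          have := mul_le_mul_of_nonneg_left hE₂ hL.le
          linarith
  exact h1.trans (add_le_add (mul_le_mul_of_nonneg_left hE₂ hD₁0) (mul_le_mul_of_nonneg_left h2 hD₂0))

end FluxBound

/-! ### Slice energy of the class in real form -/

section SliceEnergy

variable {v : ℝ → (EuclideanSpace ℝ (Fin 3)) → (EuclideanSpace ℝ (Fin 3))}

/-- Real form of the slice Morrey bound: if `∫⁻_{B(x,R)} ‖v(s)‖² ≤ A·R` (in `ℝ≥0∞`) for all balls and the slice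
is continuous, then `∫_K ‖v(s)‖² ≤ |A|·R` for every compact `K ⊆ B(x,R)`. [folklore] -/
theorem setIntegral_norm_sq_le_of_subset_ball {s : ℝ} (hvs : Continuous (v s)) {A : ℝ}
    (hA : ∀ (x : (EuclideanSpace ℝ (Fin 3))) (R : ℝ), 0 < R →
      ∫⁻ y in ball x R, ENNReal.ofReal (‖v s y‖ ^ 2) ≤ ENNReal.ofReal (A * R))
    {K : Set (EuclideanSpace ℝ (Fin 3))} {x : (EuclideanSpace ℝ (Fin 3))} {R : ℝ} (hR : 0 < R) (hKR : K ⊆ ball x R) :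
    ∫ y in K, ‖v s y‖ ^ 2 ≤ |A| * R := by
  have hc : Continuous fun y => ‖v s y‖ ^ 2 := hvs.norm.pow 2
  have iB : IntegrableOn (fun y => ‖v s y‖ ^ 2) (ball x R) :=
    (hc.continuousOn.integrableOn_compact (isCompact_closedBall x R)).mono_set ball_subset_closedBall
  calc ∫ y in K, ‖v s y‖ ^ 2 ≤ ∫ y in ball x R, ‖v s y‖ ^ 2 :=
        setIntegral_mono_set iB (Eventually.of_forall fun y => sq_nonneg _) (Eventually.of_forall hKR)
    _ = (∫⁻ y in ball x R, ENNReal.ofReal (‖v s y‖ ^ 2)).toReal :=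
        integral_eq_lintegral_of_nonneg_ae (Eventually.of_forall fun y => sq_nonneg _) hc.aestronglyMeasurable
    _ ≤ (ENNReal.ofReal (A * R)).toReal := ENNReal.toReal_mono ENNReal.ofReal_ne_top (hA x R hR)
    _ ≤ |A| * R := by
        rw [ENNReal.toReal_ofReal']
        exact max_le (mul_le_mul_of_nonneg_right (le_abs_self A) hR.le) (by positivity)

end SliceEnergy

end Summit.NavierStokesRegularity.NavierStokesRegularity.Theorems.FilamentPinchDoorFilamentPinchLiouvilleWindowCalculus

end
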